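import Summits.BirchSwinnertonDyer.BirchSwinnertonDyer.Theorems.ManinLocalTwoThreeDivisionCoverUDC
import Literature.NumberTheory.EllipticCurves.PeriodLatticeGamma1QuotientProofs
import HarnessLib

/-!
# Consumers of the `c`-DIVISION WITNESS: `Λ₁(f) ⊆ Λ` for ANY lattice witness, hence `|c₁| = 1` on `X₁(N)` and `c₀ ∈ {±1, ±2}` on `X₀(N)` at `4 ∣ N`,
# conditionally on CDT (cell bsd-f2-manin, route `ManinLocalTwoThree`, cruxes C2 stmt-BirchSwinnertonDyer-22967 / C3 stmt-…-22968; lead p1 gen 19)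

THE INPUT (an g44, E-an-242 `CDivisionWitnessLaw`; p2 g20 nodes N1–N5 `…CDivisionPoleKill`, `…CDivisionNodesOneToFive`, `…CDivisionWitnessCore`;
p3 N6–N7): for a datum with newform `f` and Néron lattice `Λ = Λ_W`, the `x`-coordinate `12·℘_Λ(E_f)·B_d·Δ^a` of the `c`-division point `u_W∘E_f`
is a holomorphic weight-`k` form whose stabiliser in `Γ₀(N)` is EXACTLY `{γ : {∞,γ∞}_f ∈ Λ}`, of exponential growth at the cusps, with algebraic-integer
`q`-expansion (Honda at the integer `1`).  This file is AGNOSTIC about the construction: it consumes any such "lattice witness" for any period pair `Λ`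
commensurable with `Λ₀(f)` (`e·Λ₀(f) ⊆ Λ` for some integer `e ≠ 0`).

THE OUTPUT.  §1 the stabiliser group `{γ ∈ Γ₀(N) : {∞,γ∞}_f ∈ Λ}` (finite index, trace-`±2` elements); §2 **lattice witness ∧ UDW ⟹ `Λ₁(f) ⊆ Λ`** — by
Unbounded Denominators the stabiliser contains some `Γ(M)`, hence `Γ(MN)`, and the `Γ₁`-Wohlfahrt lemma (`DivisionGamma1.gamma1_le_of_Gamma_le_of_forall_trace_two_mem`:
inside `Γ₁(N)` there is no index escape) puts `Γ₁(N)` in it; §3 on `X₀(N)` (`Λ = Λ_W = c·Λ₀(f)`, lattice-optimal, `4 ∣ N`): `2Λ₀ ⊆ Λ₁ ⊆ cΛ₀` forces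
**`|c| ≤ 2`**, i.e. `c₀ ∈ {±1, ±2}` (the case `±2` being the index-`4` world, an g44's `indexFour_of_cDivisionWitness_of_UDW`; so C2 ⟺ E-an-152b modulo CDT ∧ the
witness); §4 on `X₁(N)` (`Λ = Λ_{W₁} = c₁·Λ₁(f)`, `IsOptimal`, ANY level): `Λ₁ ⊆ c₁Λ₁` forces **`|c₁| = 1`** — Stevens' `c_φ = ±1` modulo CDT ∧ the `c₁`-division
witness on the `X₁(N)`-optimal datum (whose nodes N2–N5 are p2's datum-free lemmas verbatim and N1 uses `L″ = (c₁φ(N))⁻¹Λ_W`, p2 STATUS 01:0xZ); §5 C2 at the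
levels `4q² ∣ N` from §4 + the tree's two-traceless-primes ledger.
HONEST FRAMING: CONDITIONAL on the printed CDT fact and on the analytic witness rows (OPEN: N6, N7 and the `Γ₁` N1 at the time of writing); C2, C3, Stevens' and
Manin's conjectures and BSD are NOT proved by this file.  No definitions, no sorry.
[cite: CalegariDimitrovTang2025, Thm. 1.0.1 and Remarks 58–59] [cite: Wohlfahrt1964, Thm. 2] [cite: Stevens1989, §2] [cite: LingOesterle1991, Thm. 6]
[cite: Manin1972, Prop. 1.4 / Thm. 1.6] [cite: Honda1970, Thm. 9]
-/

set_option autoImplicit false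
-- lint-debt: the directory name repeats the summit name (sibling precedent `ManinLocalTwoThreeDivisionCoverUDC.lean`)
set_option linter.dupNamespace false

noncomputable section

open scoped MatrixGroups ModularForm Manifold
open CongruenceSubgroup ModularGroup
open WeierstrassCurve Literature.NumberTheory.EllipticCurves Literature.NumberTheory.EllipticCurves.ModularForms
open Literature.NumberTheory.Automorphic
open Summit.BirchSwinnertonDyer.Rank1Residual.ManinAdditive.UDCKummerLineK

namespace Summit.BirchSwinnertonDyer.BirchSwinnertonDyer.Theorems.ManinLocalTwoThree.CDivisionUDC

variable {N : ℕ} [NeZero N]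

omit [NeZero N] in
/-- Casting an integer to `ℂ`: `z = ±|z|`. [folklore] -/
theorem intCast_eq_natAbs_or (z : ℤ) : (z : ℂ) = (z.natAbs : ℂ) ∨ (z : ℂ) = -(z.natAbs : ℂ) := by
  rcases Int.natAbs_eq z with h | h
  · left
    conv_lhs => rw [h]
    simp
  · right
    conv_lhs => rw [h]
    simp

/-! ## §1 The stabiliser group `{γ ∈ Γ₀(N) : {∞,γ∞}_f ∈ Λ}` of a lattice commensurable with `Λ₀(f)` -/

/-- **The lattice-stabiliser group.**  For `f ∈ S₂(Γ₀(N))`, a period pair `Λ` and an integer `e ≠ 0` with `e·Λ₀(f) ⊆ Λ`: `{γ ∈ Γ₀(N) : {∞,γ∞}_f ∈ Λ}` is a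
subgroup of `SL₂(ℤ)` inside `Γ₀(N)` of finite index (at most `e²` cosets: classes of `e·{∞,γ∞}_f` modulo `|e|·Λ`), containing every element of `Γ₀(N)` of
trace `±2`.  For `Λ = Λ_W` of an `X₀(N)`-datum this is an g44's `c`-division cover group `Γ^{(c)}`. [cite: Manin1972, Prop. 1.4 / Thm. 1.6] -/
theorem exists_latticeStabilizerSubgroup (f : CuspForm (Gamma0 N) 2) (Λ : PeriodPair) {e : ℤ} (he : e ≠ 0)
    (hcomm : ∀ w ∈ periodLattice f, (e : ℂ) * w ∈ Λ.lattice) :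
    ∃ Γ : Subgroup SL(2, ℤ),
      (∀ γ : Gamma0 N, (γ : SL(2, ℤ)) ∈ Γ ↔ cuspSymbol f γ ∈ Λ.lattice) ∧
      Γ ≤ Gamma0 N ∧ Γ.FiniteIndex ∧
      (∀ γ ∈ Gamma0 N, (γ 0 0 + γ 1 1 = 2 ∨ γ 0 0 + γ 1 1 = -2) → γ ∈ Γ) := by
  let Γ : Subgroup SL(2, ℤ) :=
    { carrier := {g | ∃ hg : g ∈ Gamma0 N, cuspSymbol f ⟨g, hg⟩ ∈ Λ.lattice}
      one_mem' := by
        refine ⟨(Gamma0 N).one_mem, ?_⟩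
        have : (⟨1, (Gamma0 N).one_mem⟩ : Gamma0 N) = 1 := rfl
        rw [this, cuspSymbol_one]; exact zero_mem _
      mul_mem' := by
        rintro g₁ g₂ ⟨hg₁, h₁⟩ ⟨hg₂, h₂⟩
        refine ⟨(Gamma0 N).mul_mem hg₁ hg₂, ?_⟩
        have : (⟨g₁ * g₂, (Gamma0 N).mul_mem hg₁ hg₂⟩ : Gamma0 N) = ⟨g₁, hg₁⟩ * ⟨g₂, hg₂⟩ := rfl
        rw [this, cuspSymbol_mul_holds]; exact add_mem h₁ h₂
      inv_mem' := by
        rintro g ⟨hg, h⟩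
        refine ⟨(Gamma0 N).inv_mem hg, ?_⟩
        have : (⟨g⁻¹, (Gamma0 N).inv_mem hg⟩ : Gamma0 N) = ⟨g, hg⟩⁻¹ := rfl
        rw [this, cuspSymbol_inv]; exact neg_mem h }
  have hmem : ∀ γ : Gamma0 N, (γ : SL(2, ℤ)) ∈ Γ ↔ cuspSymbol f γ ∈ Λ.lattice := fun γ ↦
    ⟨fun ⟨_, h⟩ ↦ h, fun h ↦ ⟨γ.2, h⟩⟩
  refine ⟨Γ, hmem, fun g hg ↦ hg.1, ?_, ?_⟩
  · -- FINITE INDEX: classes of `e·{∞,γ∞}_f` modulo `m·Λ`, `m = |e|`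
    classical
    set m : ℕ := e.natAbs with hm_def
    have hm : 0 < m := Int.natAbs_pos.mpr he
    have hcl : ∀ γ : Gamma0 N, ∃ i j : ℕ, i < m ∧ j < m ∧ ∃ ν ∈ Λ.lattice,
        (e : ℂ) * cuspSymbol f γ - (i : ℂ) * Λ.ω₁ - (j : ℂ) * Λ.ω₂ = (m : ℂ) * ν := fun γ ↦
      DivisionGamma1.exists_sq_classes Λ hm _ (hcomm _ (cuspSymbol_mem_periodLattice f γ))
    have hrep : ∀ p : Fin m × Fin m, ∃ g : Gamma0 N, (∃ γ : Gamma0 N, ∃ ν ∈ Λ.lattice,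
        (e : ℂ) * cuspSymbol f γ - ((p.1 : ℕ) : ℂ) * Λ.ω₁ - ((p.2 : ℕ) : ℂ) * Λ.ω₂ = (m : ℂ) * ν) →
        ∃ ν ∈ Λ.lattice, (e : ℂ) * cuspSymbol f g - ((p.1 : ℕ) : ℂ) * Λ.ω₁ - ((p.2 : ℕ) : ℂ) * Λ.ω₂ = (m : ℂ) * ν := by
      intro p
      by_cases h : ∃ γ : Gamma0 N, ∃ ν ∈ Λ.lattice,
          (e : ℂ) * cuspSymbol f γ - ((p.1 : ℕ) : ℂ) * Λ.ω₁ - ((p.2 : ℕ) : ℂ) * Λ.ω₂ = (m : ℂ) * ν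
      · obtain ⟨γ, hγ⟩ := h; exact ⟨γ, fun _ ↦ hγ⟩
      · exact ⟨1, fun h' ↦ absurd h' h⟩
    choose rep hrep using hrep
    -- `m = ±e`, so `e·x ∈ mΛ ⟹ x ∈ Λ`... we only need: `e(s - s') = m(ν - ν')` ⟹ `s - s' = ±(ν - ν') ∈ Λ`
    have hsign : (e : ℂ) = (m : ℂ) ∨ (e : ℂ) = -(m : ℂ) := by
      rw [hm_def]; exact intCast_eq_natAbs_or e
    have hm0 : (m : ℂ) ≠ 0 := by exact_mod_cast hm.ne'
    have hcoset : ∀ γ : Gamma0 N, ∃ p : Fin m × Fin m, ((rep p : SL(2, ℤ)))⁻¹ * (γ : SL(2, ℤ)) ∈ Γ := by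
      intro γ
      obtain ⟨i, j, hi, hj, ν, hν, eq1⟩ := hcl γ
      set p : Fin m × Fin m := (⟨i, hi⟩, ⟨j, hj⟩) with hp
      obtain ⟨ν', hν', eq2⟩ := hrep p ⟨γ, ν, hν, by rw [hp]; exact eq1⟩
      have eq2' : (e : ℂ) * cuspSymbol f (rep p) - (i : ℂ) * Λ.ω₁ - (j : ℂ) * Λ.ω₂ = (m : ℂ) * ν' := by
        rw [hp] at eq2; exact eq2
      refine ⟨p, (hmem ((rep p)⁻¹ * γ)).mpr ?_⟩
      rw [cuspSymbol_mul_holds, cuspSymbol_inv]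
      have key : (e : ℂ) * (-cuspSymbol f (rep p) + cuspSymbol f γ) = (m : ℂ) * (ν - ν') := by
        linear_combination eq1 - eq2'
      rcases hsign with hs | hs
      · rw [hs] at key
        have : -cuspSymbol f (rep p) + cuspSymbol f γ = ν - ν' := mul_left_cancel₀ hm0 key
        rw [this]; exact sub_mem hν hν'
      · rw [hs, neg_mul, ← mul_neg] at key
        have : -cuspSymbol f (rep p) + cuspSymbol f γ = -(ν - ν') := by
          have := mul_left_cancel₀ hm0 key.symm
          linear_combination this
        rw [this]; exact neg_mem (sub_mem hν hν')
    haveI : Finite (SL(2, ℤ) ⧸ Γ) := by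
      refine Finite.of_surjective
        (fun q : (SL(2, ℤ) ⧸ Gamma0 N) × (Fin m × Fin m) ↦ (QuotientGroup.mk (q.1.out * (rep q.2 : SL(2, ℤ))) : SL(2, ℤ) ⧸ Γ)) ?_
      intro q
      induction q using QuotientGroup.induction_on with
      | H g =>
        obtain ⟨h, hh⟩ := QuotientGroup.mk_out_eq_mul (Gamma0 N) g
        obtain ⟨p, hδ⟩ := hcoset h⁻¹
        refine ⟨(QuotientGroup.mk g, p), ?_⟩
        show (QuotientGroup.mk ((QuotientGroup.mk g : SL(2, ℤ) ⧸ Gamma0 N).out * (rep p : SL(2, ℤ))) : SL(2, ℤ) ⧸ Γ) =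
          QuotientGroup.mk g
        rw [QuotientGroup.eq, hh]
        have e' : ((g : SL(2, ℤ)) * (h : SL(2, ℤ)) * (rep p : SL(2, ℤ)))⁻¹ * g =
            ((rep p : SL(2, ℤ)))⁻¹ * ((h⁻¹ : Gamma0 N) : SL(2, ℤ)) := by
          rw [Subgroup.coe_inv]; group
        rw [e']; exact hδ
    exact Subgroup.finiteIndex_of_finite_quotient
  · -- trace `±2` ⟹ zero discriminant ⟹ zero period
    intro γ hγ htr
    refine ⟨hγ, ?_⟩
    have hdet : ((γ : Matrix (Fin 2) (Fin 2) ℤ)).det = 1 := γ.2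
    have hdisc : ((((⟨γ, hγ⟩ : Gamma0 N) : SL(2, ℤ)) : Matrix (Fin 2) (Fin 2) ℤ)).discr = 0 := by
      show ((γ : Matrix (Fin 2) (Fin 2) ℤ)).discr = 0
      rw [Matrix.discr_fin_two, Matrix.trace_fin_two, hdet]
      rcases htr with h | h <;> rw [h] <;> norm_num
    rw [cuspSymbol_eq_zero_of_discr_eq_zero f hdisc]; exact zero_mem _

/-! ## §2 Lattice witness ∧ Unbounded Denominators ⟹ `Λ₁(f) ⊆ Λ` -/

/-- **A lattice witness with algebraic-integer `q`-expansion forces `Λ₁(f) ⊆ Λ`.**  If `e·Λ₀(f) ⊆ Λ` (`e ≠ 0`) and some holomorphic weight-`k` `F : ℍ → ℂ` has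
`Γ₀(N)`-stabiliser EXACTLY `{γ : {∞,γ∞}_f ∈ Λ}`, exponential growth at every cusp and an algebraic-integer `q`-expansion, then — modulo
`UnboundedDenominatorsWeightAlgInt k` — the stabiliser contains `Γ(MN)`, hence (`Γ₁`-Wohlfahrt, no index escape) `Γ₁(N)`, i.e. every `Γ₁(N)`-period of `f`
lies in `Λ`. [cite: CalegariDimitrovTang2025, Thm. 1.0.1] [cite: Wohlfahrt1964, Thm. 2] -/
theorem periodLatticeGamma1_le_of_latticeWitness_of_UDW (f : CuspForm (Gamma0 N) 2) (Λ : PeriodPair) {e : ℤ} (he : e ≠ 0)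
    (hcomm : ∀ w ∈ periodLattice f, (e : ℂ) * w ∈ Λ.lattice) {k : ℤ} (hUDW : UnboundedDenominatorsWeightAlgInt k)
    {F : UpperHalfPlane → ℂ} (hhol : MDifferentiable 𝓘(ℂ) 𝓘(ℂ) F)
    (hinv : ∀ γ : Gamma0 N, cuspSymbol f γ ∈ Λ.lattice → F ∣[k] (γ : SL(2, ℤ)) = F)
    (hstab : ∀ γ : Gamma0 N, F ∣[k] (γ : SL(2, ℤ)) = F → cuspSymbol f γ ∈ Λ.lattice)
    (hgrowth : ∀ g : SL(2, ℤ), ∃ C A r : ℝ, ∀ τ : UpperHalfPlane, A ≤ τ.im → ‖(F ∣[k] g) τ‖ ≤ C * Real.exp (r * τ.im))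
    (hq : ∃ b : ℕ → ℂ, (∀ n, IsIntegral ℤ (b n)) ∧ ∀ τ : UpperHalfPlane,
      HasSum (fun n : ℕ ↦ b n * Complex.exp (2 * Real.pi * Complex.I * (τ : ℂ) * n)) (F τ)) :
    ∀ z ∈ periodLatticeGamma1 f, z ∈ Λ.lattice := by
  obtain ⟨Γ, hmem, hle, hfi, htr⟩ := exists_latticeStabilizerSubgroup f Λ he hcomm
  have hN : 0 < N := Nat.pos_of_ne_zero (NeZero.ne N)
  have hΓinv : ∀ γ ∈ Γ, F ∣[k] γ = F := fun γ hγ ↦ hinv ⟨γ, hle hγ⟩ ((hmem ⟨γ, hle hγ⟩).mp hγ)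
  obtain ⟨M, hM, hcong⟩ := hUDW Γ hfi F hhol hΓinv hgrowth hq
  have hΓMN : CongruenceSubgroup.Gamma (M * N) ≤ Γ := by
    intro g hg
    have hgN : g ∈ CongruenceSubgroup.Gamma N := Gamma_mul_le_right M N hg
    have hgM : g ∈ CongruenceSubgroup.Gamma M := Gamma_mul_le_left M N hg
    have hg0 : g ∈ Gamma0 N := Gamma_le_Gamma0 N hgN
    exact (hmem ⟨g, hg0⟩).mpr (hstab ⟨g, hg0⟩ (hcong g hgM))
  have h1 : Gamma1 N ≤ Γ :=
    DivisionGamma1.gamma1_le_of_Gamma_le_of_forall_trace_two_mem N Γ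
      (fun γ hγ h2 ↦ htr γ (Gamma1_in_Gamma0 N hγ) (Or.inl h2)) (Nat.mul_pos hM hN) hΓMN
  -- closure induction over the generators `{∞,γ∞}_f`, `γ ∈ Γ₁(N)`
  intro z hz
  induction hz using AddSubgroup.closure_induction with
  | mem x hx =>
    obtain ⟨γ, rfl⟩ := hx
    exact (hmem _).mp (h1 γ.2)
  | zero => exact zero_mem _
  | add x y _ _ hx hy => exact add_mem hx hy
  | neg x _ hx => exact neg_mem hx

/-! ## §3 On `X₀(N)`: the `c`-division witness gives `Λ₁(f) ⊆ Λ_W = c·Λ₀(f)`, hence `|c| ≤ 2` at `4 ∣ N` -/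

section Gamma0Side

variable {W : WeierstrassCurve ℚ} [W.IsElliptic] [W.IsGloballyMinimal]

omit [W.IsElliptic] [W.IsGloballyMinimal] in
/-- **`c`-division witness ∧ UDW ⟹ `Λ₁(f) ⊆ Λ_W`** for any `X₀(N)`-datum (`e = c`: `cΛ₀(f) ⊆ Λ_W` is the datum's lattice clause).
[cite: CalegariDimitrovTang2025, Thm. 1.0.1] [cite: Wohlfahrt1964, Thm. 2] -/
theorem periodLatticeGamma1_le_neron_of_cDivisionWitness_of_UDW (D : ModularParametrizationData W N) {k : ℤ}
    (hUDW : UnboundedDenominatorsWeightAlgInt k) {F : UpperHalfPlane → ℂ} (hhol : MDifferentiable 𝓘(ℂ) 𝓘(ℂ) F)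
    (hinv : ∀ γ : Gamma0 N, cuspSymbol D.f γ ∈ D.L.lattice → F ∣[k] (γ : SL(2, ℤ)) = F)
    (hstab : ∀ γ : Gamma0 N, F ∣[k] (γ : SL(2, ℤ)) = F → cuspSymbol D.f γ ∈ D.L.lattice)
    (hgrowth : ∀ g : SL(2, ℤ), ∃ C A r : ℝ, ∀ τ : UpperHalfPlane, A ≤ τ.im → ‖(F ∣[k] g) τ‖ ≤ C * Real.exp (r * τ.im))
    (hq : ∃ b : ℕ → ℂ, (∀ n, IsIntegral ℤ (b n)) ∧ ∀ τ : UpperHalfPlane,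
      HasSum (fun n : ℕ ↦ b n * Complex.exp (2 * Real.pi * Complex.I * (τ : ℂ) * n)) (F τ)) :
    ∀ z ∈ periodLatticeGamma1 D.f, z ∈ D.L.lattice :=
  periodLatticeGamma1_le_of_latticeWitness_of_UDW D.f D.L D.maninConstant_ne_zero_holds D.smul_periodLattice_le hUDW hhol hinv hstab
    hgrowth hq

/-- **`c₀ ∈ {±1, ±2}` at `4 ∣ N` ⟸ CDT ∧ `CDivisionWitnessLaw`.**  `hCW` is an g44's row E-an-242 `CDivisionWitnessLaw` (body verbatim; nodes N1–N5 PROVED by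
p2, N6–N7 OPEN).  For a lattice-optimal `X₀(N)`-datum of a globally minimal curve at `4 ∣ N`: `Λ₁(f) ⊆ Λ_W = cΛ₀(f)` (§2) and `2Λ₀(f) ⊆ Λ₁(f)` (Ling–Oesterlé
at the traceless prime `2`) give `2Λ₀ ⊆ |c|Λ₀`, impossible for `|c| ≥ 3` (`Division.not_periodLatticeGamma1_le_mul_of_four_dvd`).  The residual `|c| = 2` is
the index-`4` world (an g44 `indexFour_of_cDivisionWitness_of_UDW`).  CONDITIONAL; C2 is not proved by this.
[cite: CalegariDimitrovTang2025, Thm. 1.0.1 and Remarks 58–59] [cite: LingOesterle1991, Thm. 6] -/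
theorem natAbs_maninConstant_le_two_of_CDT_of_cDivisionWitnessLaw
    (hCDT : Literature.NumberTheory.Automorphic.CalegariDimitrovTang2025_unboundedDenominators_algInt)
    (hCW : ∀ (W : WeierstrassCurve ℚ) [W.IsElliptic] [W.IsGloballyMinimal] {N : ℕ} [NeZero N] (D : ModularParametrizationData W N),
      ∃ (k : ℤ) (F : UpperHalfPlane → ℂ), MDifferentiable 𝓘(ℂ) 𝓘(ℂ) F ∧
        (∀ γ : Gamma0 N, cuspSymbol D.f γ ∈ D.L.lattice → F ∣[k] (γ : SL(2, ℤ)) = F) ∧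
        (∀ γ : Gamma0 N, F ∣[k] (γ : SL(2, ℤ)) = F → cuspSymbol D.f γ ∈ D.L.lattice) ∧
        (∀ g : SL(2, ℤ), ∃ C A m : ℝ, ∀ τ : UpperHalfPlane, A ≤ τ.im → ‖(F ∣[k] g) τ‖ ≤ C * Real.exp (m * τ.im)) ∧
        (∃ b : ℕ → ℂ, (∀ n, IsIntegral ℤ (b n)) ∧ ∀ τ : UpperHalfPlane,
          HasSum (fun n : ℕ ↦ b n * Complex.exp (2 * Real.pi * Complex.I * (τ : ℂ) * n)) (F τ)))
    (D : ModularParametrizationData W N) (h4 : 2 ^ 2 ∣ N) (hopt : ∀ z ∈ D.L.lattice, ∃ w ∈ periodLattice D.f, z = D.c * w) :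
    D.maninConstant.natAbs ≤ 2 := by
  by_contra hlt
  rw [not_le] at hlt
  have hm : 3 ≤ D.maninConstant.natAbs := hlt
  obtain ⟨k, F, hhol, hinv, hstab, hgrowth, hq⟩ := hCW W D
  have hle := periodLatticeGamma1_le_neron_of_cDivisionWitness_of_UDW D (UDWOfCDT.unboundedDenominatorsWeightAlgInt_of_CDT_algInt hCDT k)
    hhol hinv hstab hgrowth hq
  refine Division.not_periodLatticeGamma1_le_mul_of_four_dvd D h4 hopt hm fun z hz ↦ ?_
  -- `z ∈ Λ₁ ⊆ Λ_W = cΛ₀`, so `z = |c|·(±w)`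
  obtain ⟨w, hw, hzw⟩ := hopt z (hle z hz)
  change ∃ w ∈ periodLattice D.f, z = ((D.c.natAbs : ℕ) : ℂ) * w
  rcases intCast_eq_natAbs_or D.c with hc | hc
  · exact ⟨w, hw, by rw [hzw, hc]⟩
  · exact ⟨-w, neg_mem hw, by rw [hzw, hc]; ring⟩

end Gamma0Side

/-! ## §4 On `X₁(N)`: the `c₁`-division witness gives `Λ₁(f) ⊆ Λ_{W₁} = c₁·Λ₁(f)`, hence `|c₁| = 1` (Stevens' `c_φ = ±1`, conditional) -/

section Gamma1Side

variable {W : WeierstrassCurve ℚ} [W.IsElliptic] [W.IsGloballyMinimal]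

omit [W.IsElliptic] [W.IsGloballyMinimal] in
/-- For an `X₁(N)`-datum, `(c₁·φ(N))·Λ₀(f) ⊆ Λ_W` (`φ(N)·Λ₀(f) ⊆ Λ₁(f)` from the finite Shimura quotient, tree `totient_mul_mem_periodLatticeGamma1`), so the
lattice-stabiliser machinery applies with `e = c₁·φ(N)`. [cite: LingOesterle1991, Thm. 6] -/
theorem totient_smul_periodLattice_le (D : Gamma1ParametrizationData W N) :
    ∀ w ∈ periodLattice D.f, ((D.c * (Nat.totient N : ℤ) : ℤ) : ℂ) * w ∈ D.L.lattice := by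
  intro w hw
  have h := D.smul_periodLatticeGamma1_le _ (totient_mul_mem_periodLatticeGamma1 D.f hw)
  push_cast
  rw [mul_assoc]; exact h

omit [W.IsElliptic] [W.IsGloballyMinimal] in
/-- **`c₁`-division witness ∧ UDW ⟹ `Λ₁(f) ⊆ Λ_{W₁}`** for any `X₁(N)`-datum. [cite: CalegariDimitrovTang2025, Thm. 1.0.1] [cite: Wohlfahrt1964, Thm. 2] -/
theorem periodLatticeGamma1_le_neron₁_of_cDivisionWitness_of_UDW (D : Gamma1ParametrizationData W N) {k : ℤ}
    (hUDW : UnboundedDenominatorsWeightAlgInt k) {F : UpperHalfPlane → ℂ} (hhol : MDifferentiable 𝓘(ℂ) 𝓘(ℂ) F)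
    (hinv : ∀ γ : Gamma0 N, cuspSymbol D.f γ ∈ D.L.lattice → F ∣[k] (γ : SL(2, ℤ)) = F)
    (hstab : ∀ γ : Gamma0 N, F ∣[k] (γ : SL(2, ℤ)) = F → cuspSymbol D.f γ ∈ D.L.lattice)
    (hgrowth : ∀ g : SL(2, ℤ), ∃ C A r : ℝ, ∀ τ : UpperHalfPlane, A ≤ τ.im → ‖(F ∣[k] g) τ‖ ≤ C * Real.exp (r * τ.im))
    (hq : ∃ b : ℕ → ℂ, (∀ n, IsIntegral ℤ (b n)) ∧ ∀ τ : UpperHalfPlane,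
      HasSum (fun n : ℕ ↦ b n * Complex.exp (2 * Real.pi * Complex.I * (τ : ℂ) * n)) (F τ)) :
    ∀ z ∈ periodLatticeGamma1 D.f, z ∈ D.L.lattice := by
  have hN : (Nat.totient N : ℤ) ≠ 0 := by exact_mod_cast (Nat.totient_pos.mpr (Nat.pos_of_ne_zero (NeZero.ne N))).ne'
  exact periodLatticeGamma1_le_of_latticeWitness_of_UDW D.f D.L (mul_ne_zero D.maninConstant_ne_zero hN) (totient_smul_periodLattice_le D)
    hUDW hhol hinv hstab hgrowth hq

/-- **`|c₁| = 1` ⟸ CDT ∧ (the `c₁`-division witness law on `X₁(N)`-data) — Stevens' `c_φ = ±1` [Stevens 1989] in conditional form, at EVERY level.**  `hCW₁` is the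
`X₁(N)` twin of an g44's `CDivisionWitnessLaw` (same body with `D : Gamma1ParametrizationData`; nodes N2–N5 are p2's datum-free lemmas, N1 with
`L″ = (c₁φ(N))⁻¹Λ_W`, N6–N7 as on `X₀(N)`).  For an OPTIMAL datum (`Λ_W = c₁·Λ₁(f)`): `Λ₁(f) ⊆ Λ_W = c₁Λ₁(f)` (§2), absurd for `|c₁| ≥ 2`
(`DivisionGamma1.not_forall_gamma1_division_of_isOptimal`).  CONDITIONAL; Stevens' conjecture, Manin's conjecture and BSD are not proved by this.
[cite: Stevens1989, §2 (Conjecture: `c = ±1`)] [cite: CalegariDimitrovTang2025, Thm. 1.0.1 and Remarks 58–59] -/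
theorem abs_maninConstant₁_eq_one_of_CDT_of_cDivisionWitnessLaw₁
    (hCDT : Literature.NumberTheory.Automorphic.CalegariDimitrovTang2025_unboundedDenominators_algInt)
    (hCW₁ : ∀ (W : WeierstrassCurve ℚ) [W.IsElliptic] [W.IsGloballyMinimal] {N : ℕ} [NeZero N] (D : Gamma1ParametrizationData W N),
      ∃ (k : ℤ) (F : UpperHalfPlane → ℂ), MDifferentiable 𝓘(ℂ) 𝓘(ℂ) F ∧
        (∀ γ : Gamma0 N, cuspSymbol D.f γ ∈ D.L.lattice → F ∣[k] (γ : SL(2, ℤ)) = F) ∧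
        (∀ γ : Gamma0 N, F ∣[k] (γ : SL(2, ℤ)) = F → cuspSymbol D.f γ ∈ D.L.lattice) ∧
        (∀ g : SL(2, ℤ), ∃ C A m : ℝ, ∀ τ : UpperHalfPlane, A ≤ τ.im → ‖(F ∣[k] g) τ‖ ≤ C * Real.exp (m * τ.im)) ∧
        (∃ b : ℕ → ℂ, (∀ n, IsIntegral ℤ (b n)) ∧ ∀ τ : UpperHalfPlane,
          HasSum (fun n : ℕ ↦ b n * Complex.exp (2 * Real.pi * Complex.I * (τ : ℂ) * n)) (F τ)))
    (D : Gamma1ParametrizationData W N) (hopt : D.IsOptimal) :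
    |D.maninConstant| = 1 := by
  have hc0 : D.maninConstant ≠ 0 := D.maninConstant_ne_zero
  obtain ⟨k, F, hhol, hinv, hstab, hgrowth, hq⟩ := hCW₁ W D
  have hle := periodLatticeGamma1_le_neron₁_of_cDivisionWitness_of_UDW D (UDWOfCDT.unboundedDenominatorsWeightAlgInt_of_CDT_algInt hCDT k)
    hhol hinv hstab hgrowth hq
  rw [Int.abs_eq_natAbs]
  by_contra hne
  have hm : 2 ≤ D.maninConstant.natAbs := by
    have h1 : D.maninConstant.natAbs ≠ 1 := fun h ↦ hne (by rw [h]; rfl)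
    have h0 : D.maninConstant.natAbs ≠ 0 := Int.natAbs_ne_zero.mpr hc0
    omega
  refine DivisionGamma1.not_forall_gamma1_division_of_isOptimal D hopt hm fun γ ↦ ?_
  -- `{∞,γ∞}_f ∈ Λ₁(f) ⊆ Λ_W`, and `c₁·s = |c₁|·(±s)`
  have hs : cuspSymbol D.f ⟨(γ : SL(2, ℤ)), Gamma1_in_Gamma0 N γ.2⟩ ∈ D.L.lattice :=
    hle _ (cuspSymbol_mem_periodLatticeGamma1 D.f γ)
  change ∃ ν ∈ D.L.lattice, (D.c : ℂ) * cuspSymbol D.f ⟨(γ : SL(2, ℤ)), Gamma1_in_Gamma0 N γ.2⟩ = ((D.c.natAbs : ℕ) : ℂ) * ν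
  rcases intCast_eq_natAbs_or D.c with hc | hc
  · exact ⟨_, hs, by rw [hc]⟩
  · exact ⟨_, neg_mem hs, by rw [hc]; ring⟩

end Gamma1Side

/-! ## §5 C2 at the levels `4q² ∣ N`, modulo CDT ∧ CES ∧ the `c₁`-division witness law on `X₁(N)`-data -/

section TwoAdditivePrimes

variable {W : WeierstrassCurve ℚ} [W.IsElliptic] [W.IsGloballyMinimal]

/-- **C2 at `4 ∣ N ∧ q² ∣ N` (`q` an odd prime) ⟸ CDT ∧ CES ∧ (`c₁`-division witness law on `X₁(N)`-data).**  CES gives the optimal `X₁(N)`-datum `D₁` of the class;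
two distinct traceless primes force `|c₀| = |c₁|` unconditionally (tree `natAbs_maninConstant₀_eq_of_sq_dvd_level_of_ne`); §4 gives `|c₁| = 1`; so `|c₀| = 1` and in
particular `2 ∤ c₀` — Manin's conjecture at `2` for every optimal curve with `4q² ∣ N`, CONDITIONALLY.  The one-additive-prime case is NOT covered (index-`4` world).
[cite: CalegariDimitrovTang2025, Thm. 1.0.1] [cite: LingOesterle1991, Thm. 6] [cite: ConradEdixhovenStein2003, §6.1, Lemma 6.1.6] [cite: Stevens1989, §2] -/
theorem abs_maninConstant_eq_one_of_CDT_CES_of_cDivisionWitnessLaw₁_of_sq_dvd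
    (hCDT : Literature.NumberTheory.Automorphic.CalegariDimitrovTang2025_unboundedDenominators_algInt)
    (hCES : exists_optimal_gamma1ParametrizationData)
    (hCW₁ : ∀ (W : WeierstrassCurve ℚ) [W.IsElliptic] [W.IsGloballyMinimal] {N : ℕ} [NeZero N] (D : Gamma1ParametrizationData W N),
      ∃ (k : ℤ) (F : UpperHalfPlane → ℂ), MDifferentiable 𝓘(ℂ) 𝓘(ℂ) F ∧
        (∀ γ : Gamma0 N, cuspSymbol D.f γ ∈ D.L.lattice → F ∣[k] (γ : SL(2, ℤ)) = F) ∧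
        (∀ γ : Gamma0 N, F ∣[k] (γ : SL(2, ℤ)) = F → cuspSymbol D.f γ ∈ D.L.lattice) ∧
        (∀ g : SL(2, ℤ), ∃ C A m : ℝ, ∀ τ : UpperHalfPlane, A ≤ τ.im → ‖(F ∣[k] g) τ‖ ≤ C * Real.exp (m * τ.im)) ∧
        (∃ b : ℕ → ℂ, (∀ n, IsIntegral ℤ (b n)) ∧ ∀ τ : UpperHalfPlane,
          HasSum (fun n : ℕ ↦ b n * Complex.exp (2 * Real.pi * Complex.I * (τ : ℂ) * n)) (F τ)))
    (D : ModularParametrizationData W N) (h4 : 2 ^ 2 ∣ N) (hopt : ∀ z ∈ D.L.lattice, ∃ w ∈ periodLattice D.f, z = D.c * w)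
    {q : ℕ} (hq : q.Prime) (hq2 : q ≠ 2) (hqN : q ^ 2 ∣ N) :
    |D.maninConstant| = 1 := by
  obtain ⟨W₁, _, _, D₁, hiso, h₁⟩ := hCES W D hopt
  have heq := natAbs_maninConstant₀_eq_of_sq_dvd_level_of_ne D₁ D hiso h₁ hopt Nat.prime_two hq (Ne.symm hq2) h4 hqN
  have h1 := abs_maninConstant₁_eq_one_of_CDT_of_cDivisionWitnessLaw₁ hCDT hCW₁ D₁ h₁
  rw [Int.abs_eq_natAbs] at h1 ⊢
  rw [heq]; exact h1

end TwoAdditivePrimes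

end Summit.BirchSwinnertonDyer.BirchSwinnertonDyer.Theorems.ManinLocalTwoThree.CDivisionUDC

end
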